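import Mathlib
import HarnessLib
import Summits.HubbardSuperconductivity.HubbardSuperconductivity.Theorems.KLProgrammeKLRegimeEngineValueClausesV17FAssembly
import Summits.HubbardSuperconductivity.HubbardSuperconductivity.Theorems.KLProgrammeKLRegimeSplitSlotsV17F2
import Summits.HubbardSuperconductivity.HubbardSuperconductivity.Theorems.KLProgrammeKLRegimeEngineValueClauseReductionV10G5

/-!
# K3 ENGINE-FLOW child (gen 7-flow, stmt-HubbardSuperconductivity-20368 `KLRegimeEngineV17F`), stub (c) `stub_engine_step_values` (F shape):
# the IN-CLASS (E2″-F) from the CURED ladder clause (E2-F) on the bare-truncated array `klPairArrayF` (`…SplitSlotsV17F2`, p527694 = (R32) cure 1 as a successor module)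
# — S6 «k3c2-p2 token re-key», part 2 (cell gate-hubbard-kl, seat hubbard-kl-k3c2-p2 g7)

Port of `…ValueClauseReductionV10` §2 to the F texts: the truncation set is the bare ball `klBall L μ 0` for BOTH the array (`klPairArrayF`, cure 1 of the
BALL-MISMATCH finding KL STATUS 11:00:01Z / T2-2 11:02:58Z / (R32), landed as `…SplitSlotsV17F2` p527694) and the envelope (B1-F) `PairArrayAtV17F (n−1)`, the step clause is the cured
`PairLadderStepAtV17F2 … n` (array at `(K_{n−1}, n−1)`, amplitude at `(K_n, n)`, `+ frameShiftBar`), and the matrix algebra is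
`klvr10_pushThrough / _increment_entry_le` verbatim (generic in the truncation set):

* `klvrF_klPairArrayF_zero_snd`, `klvrF_pairArrayF_envelope`;
* **`klvrF_pairValueIncrement_inClass_of_ladder`** (generic package line `drivePBar(n−1) + E·bhi·E/(1−E·bhi) ≤ (Klam U)²·ppGain n |Qm|_𝕋`),
  **`klvrF_pairValueIncrement_inClass`** (package form: `aplus·ζ(n−1) + 10·bhi ≤ ppGain n |Qm|_𝕋` under `(C_W + klLegKappa·CR·Klam³)|U| ≤ 1/10`, `|U|·bhi ≤ 1/8`);
* `klg6_package_ineq_of_isPairClassAt` (the package line HOLDS at `klEngGeo6`: in class `ppGain = 2^28`), **`klvrF_pairValueIncrement_inClass_klEng6`**;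
* `klvrF2_stepValues_of_parts` ((c)-F2 assembly); `klbandF_pairLadderStepAtV17F2_of_le_thermalBar` ((E2-F2) band door, `w = 0`, `N = 1` on `klPairArrayF`), **`klg6F_stepValues_of_signBlind_band`**
  (the whole (c)-F conclusion in the band from one sign-blind bound);
* **`klvrF_stepValues_of_reduced`** — the (c)-F conclusion at `(klEngGeo6, Q)` from `hlad` (E2-F)_n, the (B1-F) envelope at `n−1` (= `(histP …).1.1`),
  the OUT-OF-CLASS half of (E2″-F) and (E5-F), given the two smallness lines; **`klvrF_stepValues_of_reduced_klEngU₀4`** discharges them at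
  `Q = klEngQ6 P R` from `0 < U ≤ klEngU₀4 P R c` (a tighter `klEngU₀6` composes by `le_trans`).

Bookkeeping only; nothing about the model is asserted; nothing asserts superconductivity.
-/

noncomputable section

namespace Summit.HubbardSuperconductivity.HubbardSuperconductivity.Theorems.KLRegimeSplit

set_option linter.dupNamespace false -- summit = problem name (single-conjunct summit), D-0017

open Real Finset Literature.MathematicalPhysics.QuantumLattice Literature.Probability.LatticeModels
open Summit.HubbardSuperconductivity.HubbardSuperconductivity.Theorems.KLProgrammeLegKernels
open Summit.HubbardSuperconductivity.HubbardSuperconductivity.Theorems.EngineV8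

section Model

variable {L M : ℕ} [NeZero L] [NeZero M]

/-- The bare-truncated pair array vanishes off the bare ball (second index). -/
theorem klvrF_klPairArrayF_zero_snd (β U μ : ℝ) (n : ℕ) (Qm k : TorusSite 2 L) {k' : TorusSite 2 L} (hk' : k' ∉ klBall L μ 0) :
    klPairArrayF L M β U μ n Qm k k' = 0 :=
  klPairArrayF_apply_of_not_mem_right L M β U μ n Qm k hk'

/-- **The bare-ball envelope of the flow array from (B1-F)**: `PairArrayAtV17F … n` puts every bare-ball entry of `klPairArrayF … n Qm` within
`E = 2|U| + (C_W + klLegKappa·Q.CR·Klam³)·U²` of `0`. -/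
theorem klvrF_pairArrayF_envelope {P : SplitConsts} {Q : EngConsts} {β U μ : ℝ} {n : ℕ} (harr : PairArrayAtV17F L M P Q β U μ n)
    (Qm : TorusSite 2 L) :
    ∀ p ∈ klBall L μ 0, ∀ q ∈ klBall L μ 0,
      ‖klPairArrayF L M β U μ n Qm p q‖ ≤ 2 * |U| + (P.C_W + klLegKappa * Q.CR * P.Klam ^ 3) * U ^ 2 := by
  intro p hp q hq
  obtain ⟨u, hu0, hu2, hclose⟩ := harr Qm
  rw [klPairArrayF_apply_of_mem L M β U μ n Qm hp hq]
  have h := hclose p hp q hq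
  have hu : ‖(u : ℂ)‖ ≤ 2 * |U| := by rw [Complex.norm_real, Real.norm_of_nonneg hu0]; exact hu2
  calc ‖klPairAmplitude L M β U μ (klFlowFrameU L M β U μ n) n Qm p q‖
      = ‖(klPairAmplitude L M β U μ (klFlowFrameU L M β U μ n) n Qm p q - (u : ℂ)) + (u : ℂ)‖ := by rw [sub_add_cancel]
    _ ≤ ‖klPairAmplitude L M β U μ (klFlowFrameU L M β U μ n) n Qm p q - (u : ℂ)‖ + ‖(u : ℂ)‖ := norm_add_le _ _
    _ ≤ _ := by linarith


/-! ## The (c)-F assembly with the cured first conjunct (E2-F2) -/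

/-- `klvrF_stepValues_of_parts` with the cured ladder clause `PairLadderStepAtV17F2` as the first conjunct. -/
theorem klvrF2_stepValues_of_parts {G : GeoConsts} {P : SplitConsts} {Q : EngConsts} {β U μ : ℝ} {n : ℕ}
    (hlad : PairLadderStepAtV17F2 L M G P Q β U μ n)
    (hin : ∀ Qm : TorusSite 2 L, IsPairClassAt L Qm n → ∀ k ∈ klBall L μ 0, ∀ k' ∈ klBall L μ 0,
      ‖klPairAmplitude L M β U μ (klFlowFrameU L M β U μ n) n Qm k k' -
          klPairAmplitude L M β U μ (klFlowFrameU L M β U μ (n - 1)) (n - 1) Qm k k'‖ ≤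
        gainBar G P U n (klTorusNorm L Qm) (klTorusNorm L (k - k')) (klTorusNorm L (k + k' - Qm)) +
          eremBar G P Q U β L (n - 1) + thermalBar G P U β n +
            legDressBarQ2 G P Q U n (legSliceCountT L β μ (klFlowFrameU L M β U μ n) n ![k', Qm - k', Qm - k, k]) +
              frameShiftBar P Q U n)
    (hout : ∀ Qm : TorusSite 2 L, ¬ IsPairClassAt L Qm n → ∀ k ∈ klBall L μ 0, ∀ k' ∈ klBall L μ 0,
      ‖klPairAmplitude L M β U μ (klFlowFrameU L M β U μ n) n Qm k k' -
          klPairAmplitude L M β U μ (klFlowFrameU L M β U μ (n - 1)) (n - 1) Qm k k'‖ ≤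
        gainBar G P U n (klTorusNorm L Qm) (klTorusNorm L (k - k')) (klTorusNorm L (k + k' - Qm)) +
          eremBar G P Q U β L (n - 1) + thermalBar G P U β n +
            legDressBarQ2 G P Q U n (legSliceCountT L β μ (klFlowFrameU L M β U μ n) n ![k', Qm - k', Qm - k, k]) +
              frameShiftBar P Q U n)
    (hE5 : IsoTupleL1AtV17F L M G P β U μ n) :
    PairLadderStepAtV17F2 L M G P Q β U μ n ∧ PairValueIncrementAtV17F L M G P Q β U μ n ∧
      QuarticValueIncrementAtV17F L M G P Q β U μ n ∧ IsoTupleL1AtV17F L M G P β U μ n := by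
  have h7 := klvrF_pairValueIncrementAtV17F_of_inClass_outClass hin hout
  exact ⟨hlad, h7, klvrF_quarticValueIncrementAtV17F_of_pairValueIncrementAtV17F h7, hE5⟩

/-- **In-class (E2″-F) from the cured (E2-F), generic form.**  At `1 ≤ n` and `Qm` in the pair class at resolution `n`: from `PairLadderStepAtV17F … n`,
`PairArrayAtV17F … (n−1)`, the envelope size `E := 2|U| + (C_W + klLegKappa·Q.CR·Klam³)U²` with `E·bhi < 1`, and the package line
`drivePBar(n−1) + E·bhi·E/(1−E·bhi) ≤ (Klam U)²·ppGain n |Qm|_𝕋`, the CROSS-FRAME pair-value increment obeys the (E2″-F) budget at this `Qm`. -/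
theorem klvrF_pairValueIncrement_inClass_of_ladder {G : GeoConsts} {P : SplitConsts} {Q : EngConsts} {β U μ : ℝ} {n : ℕ} (hn : 1 ≤ n)
    (hlad : PairLadderStepAtV17F2 L M G P Q β U μ n) (harr : PairArrayAtV17F L M P Q β U μ (n - 1))
    {Qm : TorusSite 2 L} (hQm : IsPairClassAt L Qm n)
    (hEm : (2 * |U| + (P.C_W + klLegKappa * Q.CR * P.Klam ^ 3) * U ^ 2) * G.bhi < 1)
    (hgain : drivePBar G P U (n - 1) +
        (2 * |U| + (P.C_W + klLegKappa * Q.CR * P.Klam ^ 3) * U ^ 2) * G.bhi *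
          ((2 * |U| + (P.C_W + klLegKappa * Q.CR * P.Klam ^ 3) * U ^ 2) /
            (1 - (2 * |U| + (P.C_W + klLegKappa * Q.CR * P.Klam ^ 3) * U ^ 2) * G.bhi)) ≤
      (P.Klam * U) ^ 2 * G.ppGain n (klTorusNorm L Qm)) :
    ∀ k ∈ klBall L μ 0, ∀ k' ∈ klBall L μ 0,
      ‖klPairAmplitude L M β U μ (klFlowFrameU L M β U μ n) n Qm k k' -
          klPairAmplitude L M β U μ (klFlowFrameU L M β U μ (n - 1)) (n - 1) Qm k k'‖ ≤
        gainBar G P U n (klTorusNorm L Qm) (klTorusNorm L (k - k')) (klTorusNorm L (k + k' - Qm)) +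
          eremBar G P Q U β L (n - 1) + thermalBar G P U β n +
            legDressBarQ2 G P Q U n (legSliceCountT L β μ (klFlowFrameU L M β U μ n) n ![k', Qm - k', Qm - k, k]) +
              frameShiftBar P Q U n := by
  intro k hk k' hk'
  set E : ℝ := 2 * |U| + (P.C_W + klLegKappa * Q.CR * P.Klam ^ 3) * U ^ 2 with hEdef
  set A := klPairArrayF L M β U μ (n - 1) Qm with hAdef
  obtain ⟨w, hw1, hw2, N, hN, hb⟩ := hlad.2 hn Qm hQm
  have hE0 : 0 ≤ E := by
    have h := klvrF_pairArrayF_envelope harr Qm k hk k hk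
    exact (norm_nonneg _).trans h
  have hA2 : ∀ p q, q ∉ klBall L μ 0 → A p q = 0 := fun p q hq => klvrF_klPairArrayF_zero_snd β U μ (n - 1) Qm p hq
  have hEnv : ∀ p ∈ klBall L μ 0, ∀ q ∈ klBall L μ 0, ‖A p q‖ ≤ E := klvrF_pairArrayF_envelope harr Qm
  have hcorr := klvr10_increment_entry_le hN hA2 hE0 hEnv hw1 hEm hk k'
  have hAkk : A k k' = klPairAmplitude L M β U μ (klFlowFrameU L M β U μ (n - 1)) (n - 1) Qm k k' :=
    klPairArrayF_apply_of_mem L M β U μ (n - 1) Qm hk hk'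
  have hstep := hb k hk k' hk'
  have htri : ‖klPairAmplitude L M β U μ (klFlowFrameU L M β U μ n) n Qm k k' -
        klPairAmplitude L M β U μ (klFlowFrameU L M β U μ (n - 1)) (n - 1) Qm k k'‖ ≤
      ‖klPairAmplitude L M β U μ (klFlowFrameU L M β U μ n) n Qm k k' - (A * N) k k'‖ + ‖(A * N) k k' - A k k'‖ := by
    rw [← hAkk]
    exact norm_sub_le_norm_sub_add_norm_sub _ _ _
  refine htri.trans ?_
  refine (add_le_add hstep hcorr).trans ?_
  unfold gainBar
  nlinarith [hgain]

/-- **In-class (E2″-F), package form**: `Klam ≥ 1`, `(C_W + klLegKappa·Q.CR·Klam³)·|U| ≤ 1/10`, `|U|·bhi ≤ 1/8` (`bhi ≥ 0`) and the single package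
inequality `aplus·ζ(n−1) + 10·bhi ≤ ppGain n |Qm|_𝕋` suffice. -/
theorem klvrF_pairValueIncrement_inClass {G : GeoConsts} {P : SplitConsts} {Q : EngConsts} {β U μ : ℝ} {n : ℕ} (hn : 1 ≤ n)
    (hlad : PairLadderStepAtV17F2 L M G P Q β U μ n) (harr : PairArrayAtV17F L M P Q β U μ (n - 1))
    {Qm : TorusSite 2 L} (hQm : IsPairClassAt L Qm n) (hK : 1 ≤ P.Klam) (hbhi : 0 ≤ G.bhi)
    (hcU : 0 ≤ P.C_W + klLegKappa * Q.CR * P.Klam ^ 3) (hcU' : (P.C_W + klLegKappa * Q.CR * P.Klam ^ 3) * |U| ≤ 1 / 10)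
    (hUb : |U| * G.bhi ≤ 1 / 8) (hgain : G.aplus * G.ζ (n - 1) + 10 * G.bhi ≤ G.ppGain n (klTorusNorm L Qm)) :
    ∀ k ∈ klBall L μ 0, ∀ k' ∈ klBall L μ 0,
      ‖klPairAmplitude L M β U μ (klFlowFrameU L M β U μ n) n Qm k k' -
          klPairAmplitude L M β U μ (klFlowFrameU L M β U μ (n - 1)) (n - 1) Qm k k'‖ ≤
        gainBar G P U n (klTorusNorm L Qm) (klTorusNorm L (k - k')) (klTorusNorm L (k + k' - Qm)) +
          eremBar G P Q U β L (n - 1) + thermalBar G P U β n +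
            legDressBarQ2 G P Q U n (legSliceCountT L β μ (klFlowFrameU L M β U μ n) n ![k', Qm - k', Qm - k, k]) +
              frameShiftBar P Q U n := by
  set c : ℝ := P.C_W + klLegKappa * Q.CR * P.Klam ^ 3 with hc
  set E : ℝ := 2 * |U| + c * U ^ 2 with hEdef
  have hU0 : 0 ≤ |U| := abs_nonneg U
  have hU2 : U ^ 2 = |U| ^ 2 := (sq_abs U).symm
  have hEle : E ≤ 21 / 10 * |U| := by
    rw [hEdef, hU2]
    nlinarith [mul_nonneg hcU hU0]
  have hEge : 0 ≤ E := by rw [hEdef, hU2]; positivity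
  have hEb : E * G.bhi ≤ 21 / 80 := by
    calc E * G.bhi ≤ 21 / 10 * |U| * G.bhi := mul_le_mul_of_nonneg_right hEle hbhi
      _ = 21 / 10 * (|U| * G.bhi) := by ring
      _ ≤ 21 / 10 * (1 / 8) := mul_le_mul_of_nonneg_left hUb (by norm_num)
      _ = 21 / 80 := by norm_num
  have hEm : E * G.bhi < 1 := by linarith
  have hden : 0 < 1 - E * G.bhi := by linarith
  have hcorr : E * G.bhi * (E / (1 - E * G.bhi)) ≤ (P.Klam * U) ^ 2 * (10 * G.bhi) := by
    have h1 : E / (1 - E * G.bhi) ≤ E / (59 / 80) := div_le_div_of_nonneg_left hEge (by norm_num) (by linarith)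
    have h2 : E * G.bhi * (E / (1 - E * G.bhi)) ≤ E * G.bhi * (E / (59 / 80)) :=
      mul_le_mul_of_nonneg_left h1 (mul_nonneg hEge hbhi)
    refine h2.trans ?_
    have h3 : E * G.bhi * (E / (59 / 80)) = 80 / 59 * E ^ 2 * G.bhi := by ring
    rw [h3]
    have h4 : E ^ 2 ≤ (21 / 10) ^ 2 * |U| ^ 2 := by
      rw [← mul_pow]; exact pow_le_pow_left₀ hEge hEle 2
    have h5 : |U| ^ 2 ≤ (P.Klam * U) ^ 2 := by
      rw [mul_pow, ← hU2]
      have h1K : (1 : ℝ) ≤ P.Klam ^ 2 := one_le_pow₀ hK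
      calc U ^ 2 = 1 * U ^ 2 := (one_mul _).symm
        _ ≤ P.Klam ^ 2 * U ^ 2 := mul_le_mul_of_nonneg_right h1K (sq_nonneg U)
    nlinarith [mul_nonneg (sq_nonneg E) hbhi, mul_nonneg (sq_nonneg (P.Klam * U)) hbhi]
  have hgain' : drivePBar G P U (n - 1) + E * G.bhi * (E / (1 - E * G.bhi)) ≤ (P.Klam * U) ^ 2 * G.ppGain n (klTorusNorm L Qm) := by
    unfold drivePBar
    have hsq : 0 ≤ (P.Klam * U) ^ 2 := sq_nonneg _
    have h := mul_le_mul_of_nonneg_left hgain hsq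
    nlinarith
  exact klvrF_pairValueIncrement_inClass_of_ladder hn hlad harr hQm hEm hgain'

omit [NeZero L] [NeZero M] in
/-- **The package line HOLDS at `klEngGeo6` in the pair class** (`aplus, ζ, bhi, ppGain` of `klEngGeo6` are `klEngGeo5`'s; in class `ppGain = 2^28`). -/
theorem klg6_package_ineq_of_isPairClassAt {Qm : TorusSite 2 L} (n : ℕ) (hQm : IsPairClassAt L Qm n) :
    klEngGeo6.aplus * klEngGeo6.ζ (n - 1) + 10 * klEngGeo6.bhi ≤ klEngGeo6.ppGain n (klTorusNorm L Qm) :=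
  klg5_package_ineq_of_isPairClassAt n hQm

/-- **In-class (E2″-F) at the package `klEngGeo6`** (any `Q` with `Q.CR ≥ 0`; the two smallness lines are the registrant's U₀-door outputs). -/
theorem klvrF_pairValueIncrement_inClass_klEng6 {P : SplitConsts} {Q : EngConsts} {β U μ : ℝ} {n : ℕ} (hP : P.WF) (hQ : Q.WF) (hn : 1 ≤ n)
    (hlad : PairLadderStepAtV17F2 L M klEngGeo6 P Q β U μ n) (harr : PairArrayAtV17F L M P Q β U μ (n - 1))
    (hcU' : (P.C_W + klLegKappa * Q.CR * P.Klam ^ 3) * |U| ≤ 1 / 10) (hUb : |U| * klEngGeo6.bhi ≤ 1 / 8)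
    {Qm : TorusSite 2 L} (hQm : IsPairClassAt L Qm n) :
    ∀ k ∈ klBall L μ 0, ∀ k' ∈ klBall L μ 0,
      ‖klPairAmplitude L M β U μ (klFlowFrameU L M β U μ n) n Qm k k' -
          klPairAmplitude L M β U μ (klFlowFrameU L M β U μ (n - 1)) (n - 1) Qm k k'‖ ≤
        gainBar klEngGeo6 P U n (klTorusNorm L Qm) (klTorusNorm L (k - k')) (klTorusNorm L (k + k' - Qm)) +
          eremBar klEngGeo6 P Q U β L (n - 1) + thermalBar klEngGeo6 P U β n +
            legDressBarQ2 klEngGeo6 P Q U n (legSliceCountT L β μ (klFlowFrameU L M β U μ n) n ![k', Qm - k', Qm - k, k]) +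
              frameShiftBar P Q U n := by
  have hK : 1 ≤ P.Klam := hP.1
  have hbhi : 0 ≤ klEngGeo6.bhi := klEngGeo6_wf.2.2.1.trans klEngGeo6_wf.2.2.2.1
  have hcU : 0 ≤ P.C_W + klLegKappa * Q.CR * P.Klam ^ 3 := by
    have h1 : 0 ≤ P.C_W := hP.2.1
    have h2 : 0 ≤ klLegKappa * Q.CR * P.Klam ^ 3 :=
      mul_nonneg (mul_nonneg (by unfold klLegKappa; norm_num) hQ.2.1) (pow_nonneg (zero_le_one.trans hK) 3)
    linarith
  exact klvrF_pairValueIncrement_inClass hn hlad harr hQm hK hbhi hcU hcU' hUb (klg6_package_ineq_of_isPairClassAt n hQm)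

/-- **The (c)-F value conjuncts from the REDUCED list at `(klEngGeo6, Q)`**: the cured ladder clause (E2-F)_n, the (B1-F) envelope at `n−1` (a
projection of the history's `BetaSplitAtV17F … (n−1)`), the OUT-OF-CLASS half of (E2″-F), (E5-F), and the two smallness lines give
`PairLadderStepAtV17F ∧ PairValueIncrementAtV17F ∧ QuarticValueIncrementAtV17F ∧ IsoTupleL1AtV17F` at `n`. -/
theorem klvrF_stepValues_of_reduced {P : SplitConsts} {Q : EngConsts} {β U μ : ℝ} {n : ℕ} (hP : P.WF) (hQ : Q.WF) (hn : 1 ≤ n)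
    (hlad : PairLadderStepAtV17F2 L M klEngGeo6 P Q β U μ n) (harr : PairArrayAtV17F L M P Q β U μ (n - 1))
    (hcU' : (P.C_W + klLegKappa * Q.CR * P.Klam ^ 3) * |U| ≤ 1 / 10) (hUb : |U| * klEngGeo6.bhi ≤ 1 / 8)
    (hout : ∀ Qm : TorusSite 2 L, ¬ IsPairClassAt L Qm n → ∀ k ∈ klBall L μ 0, ∀ k' ∈ klBall L μ 0,
      ‖klPairAmplitude L M β U μ (klFlowFrameU L M β U μ n) n Qm k k' -
          klPairAmplitude L M β U μ (klFlowFrameU L M β U μ (n - 1)) (n - 1) Qm k k'‖ ≤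
        gainBar klEngGeo6 P U n (klTorusNorm L Qm) (klTorusNorm L (k - k')) (klTorusNorm L (k + k' - Qm)) +
          eremBar klEngGeo6 P Q U β L (n - 1) + thermalBar klEngGeo6 P U β n +
            legDressBarQ2 klEngGeo6 P Q U n (legSliceCountT L β μ (klFlowFrameU L M β U μ n) n ![k', Qm - k', Qm - k, k]) +
              frameShiftBar P Q U n)
    (hE5 : IsoTupleL1AtV17F L M klEngGeo6 P β U μ n) :
    PairLadderStepAtV17F2 L M klEngGeo6 P Q β U μ n ∧ PairValueIncrementAtV17F L M klEngGeo6 P Q β U μ n ∧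
      QuarticValueIncrementAtV17F L M klEngGeo6 P Q β U μ n ∧ IsoTupleL1AtV17F L M klEngGeo6 P β U μ n :=
  klvrF2_stepValues_of_parts hlad
    (fun _ hQm => klvrF_pairValueIncrement_inClass_klEng6 hP hQ hn hlad harr hcU' hUb hQm) hout hE5


/-! ## The (E2-F) band door on the cured array (`w = 0`, `N = 1`) and the whole (c)-F conclusion in the band -/

/-- **(E2-F)_n (`n ≥ 1`) from a sign-blind cross-frame in-class increment bound inside `thermalBar`**, trivial ladder witness `w = 0`, `N = 1`
(`A·N = klPairArrayF … (n−1) Qm`, whose bare-ball entries are `𝒞_{n−1}[K_{n−1}]`). -/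
theorem klbandF_pairLadderStepAtV17F2_of_le_thermalBar {G : GeoConsts} {P : SplitConsts} {Q : EngConsts} {β U μ : ℝ} {n : ℕ}
    (hG : G.WF) (hP : P.WF) (hQ : Q.WF) (hn : 1 ≤ n)
    (h : ∀ Qm : TorusSite 2 L, IsPairClassAt L Qm n → ∀ k ∈ klBall L μ 0, ∀ k' ∈ klBall L μ 0,
      ‖klPairAmplitude L M β U μ (klFlowFrameU L M β U μ n) n Qm k k' -
          klPairAmplitude L M β U μ (klFlowFrameU L M β U μ (n - 1)) (n - 1) Qm k k'‖ ≤ thermalBar G P U β n) :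
    PairLadderStepAtV17F2 L M G P Q β U μ n := by
  have hK : 0 ≤ P.Klam := zero_le_one.trans hP.1
  have hbhi : 0 ≤ G.bhi := hG.2.2.1.trans hG.2.2.2.1
  have hph := hG.2.2.2.2.2.2.2.2.2.2.2.2.1
  refine ⟨fun h0 => absurd h0 (by omega), fun _ Qm hQm => ⟨fun _ => 0, ?_, ?_, 1, ?_, fun k hk k' hk' => ?_⟩⟩
  · simpa using hbhi
  · have := klEdge_nonneg hbhi n (klband_klTorusNorm_nonneg (L := L) Qm)
    simpa using mul_nonneg zero_le_two this
  · have h0 : (Matrix.diagonal fun _ : TorusSite 2 L => (((0 : ℝ) : ℝ) : ℂ)) = 0 := by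
      rw [Complex.ofReal_zero]; exact Matrix.diagonal_zero
    rw [h0, Matrix.zero_mul, add_zero, Matrix.mul_one]
  · rw [Matrix.mul_one, klPairArrayF_apply_of_mem L M β U μ (n - 1) Qm hk hk']
    have hdrive : 0 ≤ drivePBar G P U (n - 1) := drivePBar_nonneg' hG U (n - 1)
    have herem := eremBar_nonneg' hG hP hQ U β L (n - 1)
    have hleg := legDressBarQ2_nonneg G hK hQ.2.1 U n (legSliceCountT L β μ (klFlowFrameU L M β U μ n) n ![k', Qm - k', Qm - k, k])
    have hfs := frameShiftBar_nonneg (P := P) hQ.2.1 U n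
    have h1 := hph n (klTorusNorm L (k - k'))
    have h2 := hph n (klTorusNorm L (k + k' - Qm))
    have h3 : 0 ≤ (P.Klam * U) ^ 2 * (G.phGain n (klTorusNorm L (k - k')) + G.phGain n (klTorusNorm L (k + k' - Qm))) :=
      mul_nonneg (sq_nonneg _) (add_nonneg h1 h2)
    linarith [h Qm hQm k hk k' hk']

/-- **The whole (c)-F conclusion in the thermal band at `(klEngGeo6, Q)` from ONE sign-blind bound**: `1 ≤ n`, `nScales β ≤ n + T`,
`‖𝒞_n[K_n] − 𝒞_{n−1}[K_{n−1}]‖ ≤ Cp·(Klam U)²` on the bare ball for every `Qm`, `Cp·4^T ≤ 2^80`, and (E5-F) by name. -/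
theorem klg6F_stepValues_of_signBlind_band {P : SplitConsts} {Q : EngConsts} {β U μ : ℝ} {n T : ℕ} {Cp : ℝ} (hP : P.WF) (hQ : Q.WF)
    (hn : 1 ≤ n) (hband : nScales β ≤ n + T) (hCp : 0 ≤ Cp) (hCpT : Cp * 4 ^ T ≤ 2 ^ 80)
    (hpair : ∀ Qm : TorusSite 2 L, ∀ k ∈ klBall L μ 0, ∀ k' ∈ klBall L μ 0,
      ‖klPairAmplitude L M β U μ (klFlowFrameU L M β U μ n) n Qm k k' -
          klPairAmplitude L M β U μ (klFlowFrameU L M β U μ (n - 1)) (n - 1) Qm k k'‖ ≤ Cp * (P.Klam * U) ^ 2)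
    (hE5 : IsoTupleL1AtV17F L M klEngGeo6 P β U μ n) :
    PairLadderStepAtV17F2 L M klEngGeo6 P Q β U μ n ∧ PairValueIncrementAtV17F L M klEngGeo6 P Q β U μ n ∧
      QuarticValueIncrementAtV17F L M klEngGeo6 P Q β U μ n ∧ IsoTupleL1AtV17F L M klEngGeo6 P β U μ n := by
  have hT : ∀ Qm : TorusSite 2 L, ∀ k ∈ klBall L μ 0, ∀ k' ∈ klBall L μ 0,
      ‖klPairAmplitude L M β U μ (klFlowFrameU L M β U μ n) n Qm k k' -
          klPairAmplitude L M β U μ (klFlowFrameU L M β U μ (n - 1)) (n - 1) Qm k k'‖ ≤ thermalBar klEngGeo6 P U β n :=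
    fun Qm k hk k' hk' => klg6_band_le_thermalBar hCp hCpT hband (hpair Qm k hk k' hk')
  have h2 := klbandF_values_of_le_thermalBar (G := klEngGeo6) klEngGeo6_wf hP hQ hT
  exact ⟨klbandF_pairLadderStepAtV17F2_of_le_thermalBar klEngGeo6_wf hP hQ hn (fun Qm _ k hk k' hk' => hT Qm k hk k' hk'), h2.1, h2.2, hE5⟩


/-! ## Binder-keyed instance at `(klEngGeo6, klEngQ6 P R)` under `U ≤ klEngU₀4 P R c` (any tighter U₀, e.g. `klEngU₀6`, composes by `le_trans`) -/

/-- **The (c)-F value conjuncts under the engine's coupling binder**: at `Q = klEngQ6 P R` the two smallness lines follow from `0 < U ≤ klEngU₀4 P R c`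
(`(klEngQ6 P R).CR = (klEngQ5 P R).CR`, `klEngGeo6.bhi = 2^24`; `klEng_pairTolerance5_mul_le_of_le_klEngU₀4`, `abs_mul_two_pow_24_le_of_le_klEngU₀4`). -/
theorem klvrF_stepValues_of_reduced_klEngU₀4 {P : SplitConsts} {R : RenConsts} (hP : P.WF) (hR : R.WF) {c β U μ : ℝ} (hU : 0 < U)
    (hU₀ : U ≤ klEngU₀4 P R c) {n : ℕ} (hn : 1 ≤ n)
    (hlad : PairLadderStepAtV17F2 L M klEngGeo6 P (klEngQ6 P R) β U μ n) (harr : PairArrayAtV17F L M P (klEngQ6 P R) β U μ (n - 1))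
    (hout : ∀ Qm : TorusSite 2 L, ¬ IsPairClassAt L Qm n → ∀ k ∈ klBall L μ 0, ∀ k' ∈ klBall L μ 0,
      ‖klPairAmplitude L M β U μ (klFlowFrameU L M β U μ n) n Qm k k' -
          klPairAmplitude L M β U μ (klFlowFrameU L M β U μ (n - 1)) (n - 1) Qm k k'‖ ≤
        gainBar klEngGeo6 P U n (klTorusNorm L Qm) (klTorusNorm L (k - k')) (klTorusNorm L (k + k' - Qm)) +
          eremBar klEngGeo6 P (klEngQ6 P R) U β L (n - 1) + thermalBar klEngGeo6 P U β n +
            legDressBarQ2 klEngGeo6 P (klEngQ6 P R) U n (legSliceCountT L β μ (klFlowFrameU L M β U μ n) n ![k', Qm - k', Qm - k, k]) +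
              frameShiftBar P (klEngQ6 P R) U n)
    (hE5 : IsoTupleL1AtV17F L M klEngGeo6 P β U μ n) :
    PairLadderStepAtV17F2 L M klEngGeo6 P (klEngQ6 P R) β U μ n ∧ PairValueIncrementAtV17F L M klEngGeo6 P (klEngQ6 P R) β U μ n ∧
      QuarticValueIncrementAtV17F L M klEngGeo6 P (klEngQ6 P R) β U μ n ∧ IsoTupleL1AtV17F L M klEngGeo6 P β U μ n := by
  have hcU' : (P.C_W + klLegKappa * (klEngQ6 P R).CR * P.Klam ^ 3) * |U| ≤ 1 / 10 := by
    rw [klEngQ6_CR]; exact klEng_pairTolerance5_mul_le_of_le_klEngU₀4 hP hR hU hU₀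
  have hUb : |U| * klEngGeo6.bhi ≤ 1 / 8 := by
    rw [klEngGeo6_bhi, klEngGeo5_bhi, klEngGeo4_bhi, klEngGeo3_bhi]; exact abs_mul_two_pow_24_le_of_le_klEngU₀4 hU hU₀
  exact klvrF_stepValues_of_reduced hP (klEngQ6_wf P R) hn hlad harr hcU' hUb hout hE5

end Model

end Summit.HubbardSuperconductivity.HubbardSuperconductivity.Theorems.KLRegimeSplit

end
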